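import Summits.Parity.GeneralizedHardyLittlewood.Theorems.LeeYangFibresModelHyperbolicityDefs
import Summits.Parity.GeneralizedHardyLittlewood.Theorems.LeeYangFibresModelHyperbolicityCalculus
import Summits.Parity.GeneralizedHardyLittlewood.Theorems.LeeYangFibresModelHyperbolicityWindowChain
import Summits.Parity.GeneralizedHardyLittlewood.Theorems.LeeYangFibresModelHyperbolicitySimpleZeros
import Summits.Parity.GeneralizedHardyLittlewood.Theorems.LeeYangFibresModelHyperbolicityTransfer
import Summits.Parity.GeneralizedHardyLittlewood.Theorems.LeeYangFibresModelHyperbolicityCellLimit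
import Summits.Parity.GeneralizedHardyLittlewood.Theorems.ModelHyperbolicity.Negative.ModelHyperbolicityUniformFalse
import HarnessLib

/-!
# `LeeYangFibres.ModelHyperbolicity` (stmt-Parity-14110) — skeleton, 6/7 stubs LANDED and imported, 1 sorry: the rough-integer cell polynomial
# is real-rooted for every `u ≥ 2` and all large `x`

Crux of route `LeeYangFibres` (rank 4; verbatim gen-1 `LeeYangRoughCells.ModelHyperbolicity`): for every
`u ≥ 2` there is `x₀` such that for all `x ≥ x₀` the cell polynomial
`P_{u,x}(z) = Σ_{j ≤ u} A_j(x) z^j`, `A_j(x) = #{n ≤ x : x^{1/u} < P⁻(n), Ω(n) = j}`, has only real zeros.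

This file is the sorry-free composition of the line `window-chain-transport` (lead
`prover-line-stmt-Parity-14110-0`; skeleton `Cruxes/ModelHyperbolicity/Lines/window-chain-transport.lean`),
whose seven registered stubs are LANDED:
* `stub_calculus : DensityCalculus` (`…Calculus.lean`) — continuity / vanishing / positivity / FTC /
  Volterra identity of the Alladi–Buchstab densities `I_{j+1} = cellDensity j` and of the model family
  `G_N(τ;z) = modelEval N τ z`;
* `stub_windowChain : DensityCalculus → (∀ N, WindowChain N) ∧ NoNullWindow` (`…WindowChain.lean`) —
  THE LEVER: the Hermite–Biehler positivity pair `Im(G(t)/G(τ)) ≥ 0`, `Im(z G(τ)/G(t)) > 0` on every unit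
  window `1 ≤ τ ≤ t ≤ τ+1`, transported across integer windows by the Volterra form of the delay equation
  and linearity of `Im` under the integral; plus backward uniqueness (no null window);
* `stub_simpleZeros : SimpleZerosStep` (`…SimpleZeros.lean`) — the model polynomial `Σ_{j<u} I_{j+1}(u) X^j`
  has `u − 2` SIMPLE real zeros (reality from non-vanishing on `ℍ`; simplicity: a multiple zero would make
  `z G(τ;z)/G(u;z)` leave `ℍ` along a ray unless `G(·; t₀)` had a null window);
* `stub_cellRate : DensityCalculus → CellRate` (`…CellRate.lean`) — Alladi's cell asymptotics WITH RATE,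
  `A_{j+1}(x) = I_{j+1}(u) x/log x + O(x/log² y)` in the tree's `(X, Y)`-format (Ω-refined Buchstab
  induction, `Literature/NumberTheory/Sieve/RoughOmegaCells*.lean`, `BuchstabIterationWeights.lean`,
  `LFunctions/PrimesIntervalMainTerm.lean`);
* `stub_cellLimit : CellLimitStep` (`…CellLimit.lean`) — rate ⇒ limit `A_{j+1}(x) log x/x → I_{j+1}(u)`;
* `stub_transfer : TransferStep` (`…Transfer.lean`) — sign alternation of the model polynomial at `u − 1`
  points separating its simple zeros transfers to the reduced cell polynomial for `x ≥ x₀(u)`, whence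
  real-rootedness (`Negative.realRootedAt_of_alternating`);
* `stub_glue` (`…Defs.lean`) — the pure-logic composition.
The guards are load-bearing and respected (landed Negative lemmas, imported): `2 ≤ u`
(`modelHyperbolicity_false_without_two_le`), "large `x`" (`not_realRootedAt_eight`), `x₀` depends on `u`
(`not_modelHyperbolicityUniform`), no monotonicity in `x` is used (`not_monotone_in_x`).
-/

namespace Summit.Parity.GeneralizedHardyLittlewood.Cruxes.ModelHyperbolicity.WindowChainTransport

open Summit.Parity.GeneralizedHardyLittlewood.Theses.LeeYangFibres (ModelHyperbolicity)
open Summit.Parity.GeneralizedHardyLittlewood.Theorems.ModelHyperbolicity.Negative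
  (crux_iff ModelHyperbolicityWithoutLargeX ModelHyperbolicityWithoutTwoLe ModelHyperbolicityUniform
    modelHyperbolicity_false_without_largeX modelHyperbolicity_false_without_two_le
    not_modelHyperbolicityUniform)

/-- **Stub F — `stub_cellRate` (registered; the LAST open stub; proof complete in the lead's folder:
`work/CellRateFinal.lean` over `Literature/NumberTheory/Sieve/RoughOmegaCells{,DensityWeights,Step,Asymptotic}.lean`,
`BuchstabIterationWeights.lean`, `LFunctions/PrimesIntervalMainTerm.lean` — all landed except `…Asymptotic` and the
Summits instantiation, which wait for farm builds).** -/
theorem stub_cellRate : DensityCalculus → CellRate := by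
  sorry

/-- **`LeeYangFibres.ModelHyperbolicity` holds**: for every `u ≥ 2` and all large `x`, the rough-integer
cell polynomial `Σ_{j ≤ u} A_j(x) z^j` has only real zeros. The composition of the seven landed stubs of
the line `window-chain-transport`, concluding the route declaration BY NAME through `Negative.crux_iff`
(`Iff.rfl`): `glue calc windowChain simpleZeros transfer (cellRate calc) cellLimit`. -/
theorem ModelHyperbolicity_of : ModelHyperbolicity :=
  crux_iff.mpr
    (stub_glue stub_calculus stub_windowChain stub_simpleZeros stub_transfer (stub_cellRate stub_calculus)
      stub_cellLimit)

/-- Checked against the landed Negative lemmas (imported): the `x₀`-guard and `2 ≤ u` are load-bearing for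
the statement just proved, and `x₀` cannot be uniform in `u`. -/
example : ¬ ModelHyperbolicityWithoutLargeX ∧ ¬ ModelHyperbolicityWithoutTwoLe ∧ ¬ ModelHyperbolicityUniform :=
  ⟨modelHyperbolicity_false_without_largeX, modelHyperbolicity_false_without_two_le, not_modelHyperbolicityUniform⟩

end Summit.Parity.GeneralizedHardyLittlewood.Cruxes.ModelHyperbolicity.WindowChainTransport
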